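import Summits.QuantumFields.YangMills.Theorems.AllWindowsColdBoxBoxHighLineStep2Defs
import Mathlib.LinearAlgebra.CrossProduct

/-!
# T-S5 STEP 2 — the WICK LAYER (task statements T-S5.7a–e, T-S5.10, T-S5.11, T-S5.12, Gaussian tail; planner ym-idea-2 g18)

Second batch of typed bricks for `stub_landauSecondOrder` (S5, ⟨stmt-QuantumFields-24004⟩; plan `Cruxes/BoxHighWindowsSU22/STUB-PLAN-S5-STEP2.md`
§3–§4 and the new §8 «Wick layer»), all stated over ✓`…Theorems.AllWindowsColdBoxBoxHighLineStep2Defs` (edge chart `edgeChart H a`,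
`boxQuadForm`, `smallField`, …), provable now, by name, `--supports stmt-QuantumFields-24004`.

THE DESIGN (§8).  On the small-field set `D = smallField H s`, `s = β^{−1/2+κ₃}`, `κ₃ ∈ (θ/2, (1/2 − 4θ)/3)`, the FP-chart weight is
`w_J = e^{−β·boxQuadForm} · e^{U}` with `U = −β(S + Φ − boxQuadForm) + (log|det F_FP(U(a))| − log|det F_FP(1)|) + Σ_e log(σ(‖a_e‖)/σ(0))`,
and the interpolation `μ_t ∝ 1_D e^{−βQ + tU}`, `f(t) = Cov_t(c₀, c_T)`, `f(1) = f(0) + f′(0) + ∫(1−t)f″` is controlled WITHOUT FEYNMAN DIAGRAMS: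
* `f(0)` = the Gaussian covariance of the two plaquette costs; its main part `β²·Cov₀(|ℓ₀|², |ℓ_T|²) = (3/4)·boxDirCircSqCov H T` EXACTLY
  (**T-S5.11 `MainTermWick`**: three colours × Wick `2K²` with `K = boxDirProjKernel/(2β)` by ✓S2), i.e. `η = 3/4` before errors;
* `f′(0) = E₀[c̃₀ c̃_T Ũ]` and `f″` are bounded by CAUCHY–SCHWARZ in `L²(Gaussian)` plus EXACT PARITY (`a ↦ −a`): the cubic vertex
  `V₃ = β Σ_p c_p^{odd}` only pairs with the odd part of `c₀c_T` (`‖(c₀c_T)_odd‖₂ ≲ β^{−5/2}`), the even quadratic fluctuations (Haar `−Σ‖a_e‖²/3`,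
  ghost `G₂`, see 7c/7d) and the quartic ones have `L²`-norms `≲ H⁴(1+log H)^m/β` (**T-S5.12**), the cubic one has `E₀[V₃²] ≲ H⁴(1+log H)^m/β`
  because the cubic Wilson vertex is a TRIPLE PRODUCT `ε_{abc}` (no self-contraction: **T-S5.7a** + **12a**), and the one genuinely connected
  estimate is the decorrelation **T-S5.10** `E₀[c̃₀² V₃²] ≲ H⁴(1+log H)^m β⁻³`.  The ghost LINEAR term vanishes identically
  (`tr(F₁⁻¹ ∂F) = 0`: colour structure `pauliPerm·[a×]`, trace of an antisymmetric matrix), which is why **7d** has no linear term.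
  Resulting relative error `H¹²(1+log H)^m/β + H¹⁶ β^{−2+4κ₃} → 0` iff `θ < 1/12` (at `θ = 1/13`: all exponents negative), `η = 1/2` at the end.
* Inputs by name: ✓S1 `stub_hodgePoincare`, ✓S2 (`boxDirProjKernel_eq_hodgeForm`), ✓S3a `landauVarianceBounded`, ✓S3b `landauKernelDecay`,
  ✓T-S5.8a `cubeShellSums`, ✓8b `cubeTwoCentreSums`, ✓T-S5.9 `ghostKernelDecay`, LEAD's Gaussian engine ✓`integral_sq_mul_sq_mul_exp_quadForm'`
  / ✓`integral_prod_dotProduct_mul_exp_quadForm_eq_pairingSum'` (flatten `a : LandauFree H → ℝ³` to `LandauFree H × Fin 3 → ℝ`, precision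
  `hodgeQ ⊗ 1₃`), ✓4c-E / ✓4f / ✓4r / ✓`fpOperator_inv_of_sub_one` for 7d.

SIZES: 7a M · 7b S · 7c S · 7d M/L · 7e S · 10 M · 11 M · 12a M · 12b S/M · 12c S · 12d S · tail S.  The assembly T-S5.13 (= S5 by name from
T-S5.5J + ✓T-S5.4J `orbitNormaliserJacobianR` + T-S5.14 + 6a + 6 + this file) is the LEAD's / fcl-p3's.

HONEST LABEL: definitions and task statements only; S5, ⟨stmt-QuantumFields-24004⟩ ⟨24335⟩ ⟨24336⟩ remain OPEN; route AllWindowsColdBox is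
DRAFT; no rung is proved; the Yang–Mills mass gap is NOT proved by this file; no summit is proved by a line.
-/

set_option autoImplicit false

noncomputable section

open MeasureTheory Matrix Finset Real
open scoped Matrix
open Literature.Probability.LatticeModels (Site)
open Literature.MathematicalPhysics.QuantumFieldTheory (Plaq)
open Literature.MathematicalPhysics.QuantumFieldTheory.AxialGauge (boxEdges)
open Literature.MathematicalPhysics.QuantumFieldTheory.Balaban1983to89.B10Eq22Rescaling (sigmaSU2)
open Literature.MathematicalPhysics.QuantumLattice (LGConfig ZdEdge fundamentalRep plaquettesTouching)
open Summit.QuantumFields.YangMills.Theorems.WeakCouplingRates (boxState dirCorner plaqCostAt boxCentre plaq12At boxDirCircSqCov)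

namespace Summit.QuantumFields.YangMills.Theorems.AllWindowsColdBoxBoxHighLine

/-! ## The Gaussian reference of the chart -/

/-- The Hodge–Gaussian weight of the chart, `exp(−β·boxQuadForm H a)` (precision `2β·hodgeQ` per colour). -/
def gaussWeight (β : ℝ) (H : ℕ) (a : LandauFree H → E3) : ℝ := Real.exp (-(β * boxQuadForm H a))

/-- Gaussian average `E₀[F] = (∫ F·e^{−βQ}) / (∫ e^{−βQ})` over ALL edge fields `a : LandauFree H → ℝ³` (Lebesgue measure of the product of
Euclidean spaces). -/
def gaussAvg (β : ℝ) (H : ℕ) (F : (LandauFree H → E3) → ℝ) : ℝ :=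
  (∫ a, F a * gaussWeight β H a) / ∫ a, gaussWeight β H a

/-- Gaussian covariance `Cov₀(F, G) = E₀[FG] − E₀[F]E₀[G]`. -/
def gaussCov (β : ℝ) (H : ℕ) (F G : (LandauFree H → E3) → ℝ) : ℝ :=
  gaussAvg β H (fun a => F a * G a) - gaussAvg β H F * gaussAvg β H G

/-- Indicator of the small-field set `{∀ e, ‖a_e‖ ≤ s}` (as a real function). -/
def sfInd (H : ℕ) (s : ℝ) (a : LandauFree H → E3) : ℝ := Set.indicator (smallField H s) (fun _ => (1 : ℝ)) a

/-! ## Linear (Gaussian) objects: linearised curvature and divergence -/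

/-- Linearised curvature of the plaquette `p`, colour `c`: `ℓ_p^c(a) = landauCoeff H p · a^c` (the signed sum of the free edge variables
around `p`; pinned edges contribute `0`). -/
def linCurv (H : ℕ) (p : Plaq 4) (a : LandauFree H → E3) (c : Fin 3) : ℝ := landauCoeff H p ⬝ᵥ colour a c

/-- `|ℓ_p(a)|² = Σ_c (ℓ_p^c)²` — the Gaussian (quadratic) part of the plaquette cost in the chart. -/
def linCurvSq (H : ℕ) (p : Plaq 4) (a : LandauFree H → E3) : ℝ := ∑ c : Fin 3, linCurv H p a c ^ 2

/-- Linearised divergence at the site `x`, colour `c`: `(d*a)_x^c = gradVec H x · a^c`. -/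
def divLin (H : ℕ) (x : Site 4) (a : LandauFree H → E3) (c : Fin 3) : ℝ := gradVec H x ⬝ᵥ colour a c

/-- `Σ_{x interior} |(d*a)_x|²` — the Gaussian part of the gauge-fixing functional `Φ` in the chart. -/
def divLinSq (H : ℕ) (a : LandauFree H → E3) : ℝ := ∑ x ∈ interiorSites H, ∑ c : Fin 3, divLin H x a c ^ 2

/-! ## Plaquette-local variables and the triple-product form -/

/-- The four edges of the plaquette based at `x` in the `(μ, ν)` plane, in holonomy order `(x,μ), (x+μ,ν), (x+ν,μ), (x,ν)`
(✓`plaquetteHolonomyZd U x μ ν = U(x,μ) U(x+μ,ν) U(x+ν,μ)⁻¹ U(x,ν)⁻¹`). -/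
def plaqEdge (x : Site 4) (μ ν : Fin 4) : Fin 4 → ZdEdge 4 :=
  ![(x, μ), (x + Pi.single μ 1, ν), (x + Pi.single ν 1, μ), (x, ν)]

/-- The four edge variables of a plaquette in the chart (zero on pinned / non-box edges). -/
def plaqVar (H : ℕ) (x : Site 4) (μ ν : Fin 4) (a : LandauFree H → E3) : Fin 4 → E3 := fun i => freeVec H a (plaqEdge x μ ν i)

/-- The signed sum `v₀ + v₁ − v₂ − v₃` (orientation of the holonomy). -/
def plaqLin (v : Fin 4 → E3) : E3 := v 0 + v 1 - v 2 - v 3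

/-- A triple-product form in four vectors: `Σ_{ijk} T_{ijk} · v_i · (v_j × v_k)` — the shape of the CUBIC Taylor term of the Wilson plaquette
cost (`(A·σ)(B·σ) = A·B + iσ·(A×B)`; every real cubic term of `Re tr Π exp(±i a_i·σ)` is a triple product). -/
def tripleForm (T : Fin 4 → Fin 4 → Fin 4 → ℝ) (v : Fin 4 → E3) : ℝ :=
  ∑ i : Fin 4, ∑ j : Fin 4, ∑ k : Fin 4, T i j k * (WithLp.ofLp (v i) ⬝ᵥ (WithLp.ofLp (v j) ⨯₃ WithLp.ofLp (v k)))

/-! ## The plaquette cost in the chart, its odd part, the cubic vertex, the quartic pieces -/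

/-- The cost `2 − Re tr U_p` of the plaquette `(x, μ, ν)` at `U = edgeChart H a`. -/
def chartPlaqCost (H : ℕ) (x : Site 4) (μ ν : Fin 4) (a : LandauFree H → E3) : ℝ :=
  plaqCostAt (G := SU2) (fundamentalRep (Fin 2)) x μ ν (edgeChart H a)

/-- Its ODD part under `a ↦ −a`: `(c_p(a) − c_p(−a))/2` (= the cubic Taylor term `+ O(‖a‖⁵)` near `0`, 7a). -/
def chartPlaqCostOdd (H : ℕ) (x : Site 4) (μ ν : Fin 4) (a : LandauFree H → E3) : ℝ :=
  (chartPlaqCost H x μ ν a - chartPlaqCost H x μ ν (-a)) / 2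

/-- **The cubic vertex** `V₃(a) = β · Σ_{p touching the box} c_p^{odd}(a)` (an odd function of `a`). -/
def cubicVertex (β : ℝ) (H : ℕ) (a : LandauFree H → E3) : ℝ :=
  β * ∑ p ∈ plaquettesTouching (boxEdges 4 (2 * H + 1)), chartPlaqCostOdd H p.1 p.2.1.1 p.2.1.2 a

/-- **The even non-Gaussian part of the Wilson action in the chart**: `β · Σ_p (c_p − |ℓ_p|² − c_p^{odd})` (quartic and higher, even). -/
def quarticWilson (β : ℝ) (H : ℕ) (a : LandauFree H → E3) : ℝ :=
  β * ∑ p ∈ plaquettesTouching (boxEdges 4 (2 * H + 1)),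
    (chartPlaqCost H p.1 p.2.1.1 p.2.1.2 a - linCurvSq H (p.1, p.2.1.1, p.2.1.2) a - chartPlaqCostOdd H p.1 p.2.1.1 p.2.1.2 a)

/-- The cubic edge field `‖a_e‖² a_e` (from `sinc r = 1 − r²/6 + …`). -/
def cubeField {H : ℕ} (a : LandauFree H → E3) : LandauFree H → E3 := fun e => ‖a e‖ ^ 2 • a e

/-- The quartic Taylor term of `Φ(U(a)) = Σ_x |(d*(sinc‖a‖·a))_x|²`: `−(1/3) Σ_x (d*a)_x · (d*(‖a‖²a))_x`. -/
def phiQuartic (H : ℕ) (a : LandauFree H → E3) : ℝ :=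
  -(1 / 3) * ∑ x ∈ interiorSites H, ∑ c : Fin 3, divLin H x a c * divLin H x (cubeField a) c

/-- Flattening `a : LandauFree H → ℝ³` to a scalar field on `LandauFree H × Fin 3` (the index type of LEAD's Gaussian engine). -/
def flat {H : ℕ} (a : LandauFree H → E3) : LandauFree H × Fin 3 → ℝ := fun i => a i.1 i.2

/-- The quadratic form `a · M a` of a matrix on the flattened index type. -/
def quadVal {H : ℕ} (M : Matrix (LandauFree H × Fin 3) (LandauFree H × Fin 3) ℝ) (a : LandauFree H → E3) : ℝ :=
  flat a ⬝ᵥ (M *ᵥ flat a)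

/-! ## T-S5.7 — local Taylor structure -/

/-- **T-S5.7a `WilsonPlaquetteTaylor`** (M) — the Wilson plaquette cost in the chart to fourth order, with the CUBIC TERM A TRIPLE PRODUCT:
there are `C` and, for each plane `μ ≠ ν`, bounded coefficients `T_{ijk}` such that whenever the four edge variables of the plaquette have norm
`≤ t ≤ 1`: `|c_p − |ℓ_p|² − c_p^{odd}| ≤ C t⁴` (even remainder) and `|c_p^{odd} − Σ T_{ijk} v_i·(v_j × v_k)| ≤ C t⁵`
(BCH/Euler in `SU(2)`: `U_p = exp(i f·σ)`, `c_p = 2 − 2cos|f|`, `f = ℓ − Σ_{i<j} s_i s_j v_i × v_j + O(3)`; ✓`coe_expPauli`, Euler's formula). -/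
def WilsonPlaquetteTaylor : Prop :=
  ∃ C : ℝ, ∀ μ ν : Fin 4, μ ≠ ν → ∃ T : Fin 4 → Fin 4 → Fin 4 → ℝ, (∀ i j k, |T i j k| ≤ C) ∧
    ∀ (H : ℕ) (x : Site 4) (t : ℝ) (a : LandauFree H → E3), 0 ≤ t → t ≤ 1 → (∀ i, ‖plaqVar H x μ ν a i‖ ≤ t) →
      |chartPlaqCost H x μ ν a - ‖plaqLin (plaqVar H x μ ν a)‖ ^ 2 - chartPlaqCostOdd H x μ ν a| ≤ C * t ^ 4 ∧
      |chartPlaqCostOdd H x μ ν a - tripleForm T (plaqVar H x μ ν a)| ≤ C * t ^ 5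

/-- **T-S5.7b `PhiTaylor`** (S) — the gauge-fixing functional in the chart is EVEN and equals its quadratic part plus `phiQuartic` to sixth order:
`Φ(U(−a)) = Φ(U(a))` and, for all `‖a_e‖ ≤ t ≤ 1`, `|Φ(U(a)) − Σ_x|(d*a)_x|² − phiQuartic| ≤ C·H⁴·t⁶`; moreover the GLOBAL quartic bound
`|Φ(U(a)) − Σ_x|(d*a)_x|²| ≤ C Σ_x (Σ_{e ∋ x} ‖a_e‖²)²` holds with no smallness (✓`landauPhi_eq_sum_gradVec_sq`, `imVec ∘ expPauli = sinc·pauliPerm`,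
`pauliPerm` orthogonal). -/
def PhiTaylor : Prop :=
  ∃ C : ℝ, ∀ H : ℕ, 1 ≤ H → ∀ a : LandauFree H → E3,
    landauPhi H (edgeChart H (-a)) = landauPhi H (edgeChart H a) ∧
    |landauPhi H (edgeChart H a) - divLinSq H a| ≤
      C * ∑ x ∈ interiorSites H, (∑ e : LandauFree H, |gradVec H x e| * ‖a e‖ ^ 2) ^ 2 ∧
    ∀ t : ℝ, 0 ≤ t → t ≤ 1 → (∀ e, ‖a e‖ ≤ t) →
      |landauPhi H (edgeChart H a) - divLinSq H a - phiQuartic H a| ≤ C * (H : ℝ) ^ 4 * t ^ 6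

/-- **T-S5.7c `HaarTaylor`** (S) — `log(σ(r)/σ(0)) = log sinc² r = −r²/3 + O(r⁴)` on `[0,1]` (✓`sigmaSU2`, `Real.sin` bounds). -/
def HaarTaylor : Prop :=
  ∃ C : ℝ, ∀ r : ℝ, 0 ≤ r → r ≤ 1 → |Real.log (sigmaSU2 r / sigmaSU2 0) + r ^ 2 / 3| ≤ C * r ^ 4

/-- **T-S5.7d `GhostTaylor`** (M/L) — the Faddeev–Popov log-determinant in the chart to second order, with NO linear term and a quadratic form of
controlled Hilbert–Schmidt size: for each `H` there is a matrix `M_H` with `Σ M_{ij}² ≤ C H⁴ (1+log H)^m` such that for all `‖a_e‖ ≤ t`,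
`t·H² ≤ c₀`: `|log|det F(U(a))| − log|det F(1)| − a·M_H a| ≤ C·H⁶(1+log H)^m·t³`
(`F(U(a)) = F₁ + F⁽¹⁾(a) + F⁽²⁾(a) + O(t³)` entrywise-local; `X = F₁⁻¹(F − F₁)`, `‖X‖_op ≤ C H² t` by ✓4f, `log det(1+X) = tr X − ‖·‖²-terms + R`,
`|R| ≤ ‖X‖_HS² ‖X‖_op/(3(1−‖X‖))`; the LINEAR term `tr(F₁⁻¹F⁽¹⁾(a))` VANISHES — `F⁽¹⁾` has colour structure `pauliPerm·[a_e×]`, ✓`pauliPerm_mul_self`,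
trace of an antisymmetric matrix — and `M_H = (tr F₁⁻¹F⁽²⁾) − ½ tr((F₁⁻¹F⁽¹⁾)²)` has entries `≲ G(e,e′)²`, ✓T-S5.9 `ghostKernelDecay`). -/
def GhostTaylor : Prop :=
  ∃ C c₀ : ℝ, ∃ m : ℕ, 0 < c₀ ∧ ∀ H : ℕ, 1 ≤ H →
    ∃ M : Matrix (LandauFree H × Fin 3) (LandauFree H × Fin 3) ℝ,
      (∑ i, ∑ j, M i j ^ 2 ≤ C * (H : ℝ) ^ 4 * (1 + Real.log H) ^ m) ∧
      ∀ (t : ℝ) (a : LandauFree H → E3), 0 ≤ t → t * (H : ℝ) ^ 2 ≤ c₀ → (∀ e, ‖a e‖ ≤ t) →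
        |Real.log |(fpOperator H (edgeChart H a)).det| - Real.log |(fpOperator H 1).det| - quadVal M a| ≤
          C * (H : ℝ) ^ 6 * (1 + Real.log H) ^ m * t ^ 3

/-- **T-S5.7e `QuadFormSplit`** (S) — the Hodge form of the chart IS the linearised action plus the linearised gauge-fixing term:
`Σ_{p touching the box} |ℓ_p|² + Σ_{x interior} |(d*a)_x|² = boxQuadForm H a`, and `ℓ_p` is the signed edge sum around `p`
(✓`hodgeQ = Qmat + Σ_x g_x g_xᵀ`, ✓`dotProduct_Qmat_mulVec`, `plaquettesIn` = all four corners in `[−1, 2H+1]⁴`, `μ < ν`, single count; plaquettes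
without a box edge have `landauCoeff = 0`). -/
def QuadFormSplit : Prop :=
  ∀ H : ℕ, 1 ≤ H → ∀ a : LandauFree H → E3,
    (∑ p ∈ plaquettesTouching (boxEdges 4 (2 * H + 1)), linCurvSq H (p.1, p.2.1.1, p.2.1.2) a) + divLinSq H a = boxQuadForm H a ∧
    ∀ (x : Site 4) (μ ν : Fin 4) (c : Fin 3), μ < ν → linCurv H (x, μ, ν) a c = plaqLin (plaqVar H x μ ν a) c

/-! ## T-S5.11 — the main term -/

/-- **T-S5.11 `MainTermWick`** (M) — under the Hodge Gaussian the connected two-point function of the QUADRATIC parts of the two plaquette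
costs is exactly `3/4` of the Dirichlet surrogate: `β² · Cov₀(|ℓ_{p₀}|², |ℓ_{p_T}|²) = (3/4) · boxDirCircSqCov H T`
(three colours; per colour Wick gives `2·(K/(2β))²` with `K = landauCoeff_{p₀}·hodgeQ⁻¹·landauCoeff_{p_T} = boxDirProjKernel H p₀ p_T` by ✓S2
`boxDirProjKernel_eq_hodgeForm`; ✓`boxDirCircSqCov_eq_two_mul_sq`, ✓`integral_dirCirc_mul_eq_boxDirProjKernel`; LEAD's
✓`integral_sq_mul_sq_mul_exp_quadForm'` after flattening, ✓S1 for positive definiteness). -/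
def MainTermWick : Prop :=
  ∀ H : ℕ, 1 ≤ H → ∀ β : ℝ, 0 < β → ∀ T : ℕ,
    β ^ 2 * gaussCov β H (linCurvSq H (plaq12At (boxCentre H))) (linCurvSq H (plaq12At (boxCentre H + Pi.single 0 (T : ℤ)))) =
      3 / 4 * boxDirCircSqCov H T

/-! ## T-S5.12 — the L² budget of the perturbation under the Gaussian -/

/-- **T-S5.12a `CubicVariance`** (M) — `E₀[V₃²] ≤ C·H⁴(1+log H)^m/β` for `β ≥ H⁴ ≥ 1`: the cubic vertex is a sum over plaquettes of triple
products (7a) plus `O(‖a‖⁵)`; `E₀[V₃] = 0` by parity; in `E₀[P₃,p P₃,p′]` NO SELF-CONTRACTION survives (`ε_{abc}δ_{ab} = 0`), so all three Wick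
lines join `p` to `p′`: `β²·β⁻³·Σ_{p,p′} |G(p,p′)|³ ≲ H⁴(1+log H)^m/β` (✓S3a/S3b, ✓8b `cubeTwoCentreSums`); the quintic remainder costs
`β² H⁸ E₀‖a‖¹⁰ ≲ H⁸β⁻³ ≤ H⁴/β`. -/
def CubicVariance : Prop :=
  ∃ C : ℝ, ∃ m : ℕ, ∀ H : ℕ, 1 ≤ H → ∀ β : ℝ, (H : ℝ) ^ 4 ≤ β →
    gaussAvg β H (fun a => cubicVertex β H a ^ 2) ≤ C * (H : ℝ) ^ 4 * (1 + Real.log H) ^ m / β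

/-- **T-S5.12b `QuadFormFluct`** (S/M) — Gaussian variance of a quadratic form: `Var₀(a·Ma) ≤ C·(H⁴/β²)·Σ M_{ij}²`
(`Var(a·Ma) = 2 tr((M_s Σ)²) ≤ 2‖Σ‖_op² ‖M‖_HS²`, `Σ = (2β)⁻¹ hodgeQ⁻¹ ⊗ 1₃`, `‖hodgeQ⁻¹‖_op ≤ H²/c₁` by ✓S1 `stub_hodgePoincare`).
Consumers: the Haar quadratic `Σ_e‖a_e‖²/3` (`M = 1/3`, `Σ M² ≤ H⁴`) and the ghost form `M_H` of 7d. -/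
def QuadFormFluct : Prop :=
  ∃ C : ℝ, ∀ H : ℕ, 1 ≤ H → ∀ β : ℝ, 0 < β → ∀ M : Matrix (LandauFree H × Fin 3) (LandauFree H × Fin 3) ℝ,
    gaussCov β H (quadVal M) (quadVal M) ≤ C * ((H : ℝ) ^ 4 / β ^ 2) * ∑ i, ∑ j, M i j ^ 2

/-- **T-S5.12c `QuarticL2`** (S) — the even non-Gaussian parts of the action have `L²(Gaussian)`-size `≲ H⁴/β` (pointwise `|·| ≤ C Σ ‖a‖⁴`-type
bounds from 7a (with the trivial `|c_p| ≤ 4` off `‖a‖ ≤ 1`) and 7b, and Gaussian eighth moments ✓S3a): for `β ≥ H⁴ ≥ 1`,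
`E₀[quarticWilson²] ≤ C H⁸/β²` and `E₀[(β(Φ − Σ|d*a|²))²] ≤ C H⁸/β²`. -/
def QuarticL2 : Prop :=
  ∃ C : ℝ, ∀ H : ℕ, 1 ≤ H → ∀ β : ℝ, (H : ℝ) ^ 4 ≤ β →
    gaussAvg β H (fun a => quarticWilson β H a ^ 2) ≤ C * (H : ℝ) ^ 8 / β ^ 2 ∧
    gaussAvg β H (fun a => (β * (landauPhi H (edgeChart H a) - divLinSq H a)) ^ 2) ≤ C * (H : ℝ) ^ 8 / β ^ 2

/-- **T-S5.12d `PlaquetteObsL2`** (S) — Gaussian sizes of ONE plaquette observable (uniformly in the base point): `E₀[|ℓ_p|⁴] ≤ C/β²`,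
`E₀[(c_p^{odd})²] ≤ C/β³`, `E₀[(c_p − |ℓ_p|² − c_p^{odd})²] ≤ C/β⁴` for `β ≥ 1` (7a + ✓S3a moments). -/
def PlaquetteObsL2 : Prop :=
  ∃ C : ℝ, ∀ H : ℕ, 1 ≤ H → ∀ β : ℝ, 1 ≤ β → ∀ x : Site 4,
    gaussAvg β H (fun a => linCurvSq H (plaq12At x) a ^ 2) ≤ C / β ^ 2 ∧
    gaussAvg β H (fun a => chartPlaqCostOdd H x 1 2 a ^ 2) ≤ C / β ^ 3 ∧
    gaussAvg β H (fun a => (chartPlaqCost H x 1 2 a - linCurvSq H (plaq12At x) a - chartPlaqCostOdd H x 1 2 a) ^ 2) ≤ C / β ^ 4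

/-! ## T-S5.10 — the one connected estimate -/

/-- **T-S5.10 `CubicDecorrelation`** (M) — the centred quadratic plaquette observable decorrelates from the cubic vertex in `L²`:
`E₀[(|ℓ_p|² − E₀|ℓ_p|²)² · V₃²] ≤ C (1+log H)^m · H⁴ · β⁻³` for `β ≥ H⁴ ≥ 1`, uniformly in the base point
(= `E₀[X̃²]·E₀[V₃²]` + connected Wick terms; every connected term routes at least two extra propagators through `p`, ✓S3b decay + ✓8a/8b sums,
so it is `≲ β⁻³(1+log H)^m ≤` the product term). This is the ONLY place where a diagram with more than two vertices is summed. -/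
def CubicDecorrelation : Prop :=
  ∃ C : ℝ, ∃ m : ℕ, ∀ H : ℕ, 1 ≤ H → ∀ β : ℝ, (H : ℝ) ^ 4 ≤ β → ∀ x : Site 4,
    gaussAvg β H (fun a =>
        (linCurvSq H (plaq12At x) a - gaussAvg β H (linCurvSq H (plaq12At x))) ^ 2 * cubicVertex β H a ^ 2) ≤
      C * (1 + Real.log H) ^ m * (H : ℝ) ^ 4 / β ^ 3

/-! ## Gaussian small-field tail -/

/-- **T-S5.6g `GaussianSmallFieldTail`** (S) — under the Hodge Gaussian the complement of the small-field set is exponentially rare: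
`E₀[1 − 1_{smallField s}] ≤ C·H⁴·exp(−c β s²)` (✓S3a `landauVarianceBounded`: `Var₀(a_e^c) ≤ C/(2β)`, Gaussian tail, union over `≤ C H⁴` edges). -/
def GaussianSmallFieldTail : Prop :=
  ∃ C c : ℝ, 0 < c ∧ ∀ H : ℕ, 1 ≤ H → ∀ β s : ℝ, 0 < β → 0 < s →
    gaussAvg β H (fun a => 1 - sfInd H s a) ≤ C * (H : ℝ) ^ 4 * Real.exp (-(c * β * s ^ 2))

/-! Sanity. -/
example {H : ℕ} (a : LandauFree H → E3) : flat (-a) = -flat a := by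
  funext i; rfl

example : WilsonPlaquetteTaylor → PhiTaylor → HaarTaylor → GhostTaylor → QuadFormSplit → MainTermWick → CubicVariance →
    QuadFormFluct → QuarticL2 → PlaquetteObsL2 → CubicDecorrelation → GaussianSmallFieldTail → True :=
  fun _ _ _ _ _ _ _ _ _ _ _ _ => trivial

end Summit.QuantumFields.YangMills.Theorems.AllWindowsColdBoxBoxHighLine

end
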